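import Summits.CriticalPhenomena.PercolationContinuityZ3.Theorems.PercGamblersRuinVerticalGamblersRuinStubExitTimeBound

/-!
# Route `PercGamblersRuin`, crux `VerticalGamblersRuin` (stmt-CriticalPhenomena-10642):
# stub `stub_fourthMoment` — annealed fourth moment of the height at a deterministic time

Helper file for the stub `stub_fourthMoment` of the line `registered` (skeleton rev 9) of the crux
`PercGamblersRuin.VerticalGamblersRuin`.  Setting: bond configurations `ω` on `ℤ³` under
`P = P_{p_c}`; `N_ω(x)` = lattice neighbours `y ∼ x` with `s(x, y)` open, `deg_ω(0) = #N_ω(0) ≤ 6`;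
height `h z = z₀`; drift `D ω z = (∑_{y ∈ N_ω(z)} (h y - h z)) / #N_ω(z)`; `𝒫_ω` the one-step
averaging operator of the SRW on the open lattice edges (pinned by `hPop`); path functional
`E ω T x G = E^ω_x[G [X_0, …, X_T]]` (pinned by its first-step recursion; no definitions).

Statement proved (exact registered signature): `∫_{0↔∞} deg_ω(0)·(𝒫_ω^T h⁴)(0) dP ≤ 1782·T²`
for `T ≥ 1`.  Proof (Lyons–Zheng at the endpoint): (i) QUENCHED FOURTH MOMENT of the forward
martingale `M^a_t(l) = h x_t - a - ∑_{s<t} d x_s` in the abstract setting of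
`StubForwardKolmogorov` (induction on `T` by consing, one-step bound
`(c + ξ)⁴ ≤ c⁴ + 40c² + 32 + 4c³ξ` for `|ξ| ≤ 2`, `∑_y ξ_y = 0`, `orthogonality`):
`F T x ((M^a_T)⁴) ≤ (h x - a)⁴ + 40T(h x - a)² + 80T²`, so `E^ω_0[M_T⁴] ≤ 80T²`; (ii) PATHWISE, for a
nearest-neighbour open path `l` from `0`, `l' = rev l - x_T`, `ω' = ω - x_T`:
`2 h x_T = M_T(ω,l) - M_T(ω',l') + D ω x_0 - D ω x_T` (`StubExitTimeBound.telescope`,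
`rev_functional`), `|D| ≤ 1`, `|M_T| ≤ 2T`, so with `G ω l = min 1 (M_T(ω,l)⁴/(16T⁴)) ∈ [0,1]`:
`h(x_T)⁴ ≤ 27T⁴(G ω l + G ω' l') + 27`; (iii) `E ω T 0` only sees such paths (`mono_chain`), LINK
`(𝒫^T h⁴)(0) = E ω T 0 (l ↦ h(x_T)⁴)` (`stub_pathFunctionalBasics`), linearity, REVERSAL
(`stub_pathReversal`: `∫ deg·E(G ω' l') = ∫ deg·E(G ω)`), `16T⁴·E(G ω) ≤ 80T²`, `deg ≤ 6`.

References: R. Lyons, Y. Peres, *Probability on Trees and Networks*, CUP (2016), §2.1, §13.1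
(forward/backward martingale decomposition); T. Lyons, W. Zheng, *A crossing estimate for the
canonical process on a Dirichlet space and a tightness result*, Astérisque 157–158 (1988), 249–271.
-/

noncomputable section

namespace Summit.CriticalPhenomena.PercolationContinuityZ3.Theorems.VerticalGamblersRuin

open MeasureTheory Filter Topology
open Literature.Probability.Percolation Literature.Probability.LatticeModels
open scoped Classical

namespace StubFourthMoment

/-- **One step of the fourth moment**: for `|ξ| ≤ 2`, `(c + ξ)⁴ ≤ c⁴ + 40 c² + 32 + 4 c³ ξ`. -/
theorem add_pow_four_le (c ξ : ℝ) (hξ : |ξ| ≤ 2) :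
    (c + ξ) ^ 4 ≤ c ^ 4 + 40 * c ^ 2 + 32 + 4 * c ^ 3 * ξ := by
  obtain ⟨h1, h2⟩ := abs_le.1 hξ
  have hsq : ξ ^ 2 ≤ 4 := by nlinarith
  have k1 : 0 ≤ c ^ 2 * (4 - ξ ^ 2) := mul_nonneg (sq_nonneg c) (by linarith)
  have k2 : 0 ≤ ξ ^ 2 * (4 - ξ ^ 2) := mul_nonneg (sq_nonneg ξ) (by linarith)
  nlinarith [sq_nonneg (2 * c * ξ - ξ ^ 2), k1, k2]

/-- **Power mean**: `(u + v + w)⁴ ≤ 27 (u⁴ + v⁴ + w⁴)`. -/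
theorem add_add_pow_four_le (u v w : ℝ) : (u + v + w) ^ 4 ≤ 27 * (u ^ 4 + v ^ 4 + w ^ 4) := by
  have h2 : (u + v + w) ^ 2 ≤ 3 * (u ^ 2 + v ^ 2 + w ^ 2) := by
    nlinarith [sq_nonneg (u - v), sq_nonneg (v - w), sq_nonneg (u - w)]
  have h4 : (u ^ 2 + v ^ 2 + w ^ 2) ^ 2 ≤ 3 * (u ^ 4 + v ^ 4 + w ^ 4) := by
    nlinarith [sq_nonneg (u ^ 2 - v ^ 2), sq_nonneg (v ^ 2 - w ^ 2), sq_nonneg (u ^ 2 - w ^ 2)]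
  calc (u + v + w) ^ 4 = ((u + v + w) ^ 2) ^ 2 := by ring
    _ ≤ (3 * (u ^ 2 + v ^ 2 + w ^ 2)) ^ 2 := pow_le_pow_left₀ (sq_nonneg _) h2 2
    _ ≤ 27 * (u ^ 4 + v ^ 4 + w ^ 4) := by nlinarith [h4]

variable {V : Type*} {v₀ : V} {N : V → Finset V} {F : ℕ → V → (List V → ℝ) → ℝ}
  {hgt d : V → ℝ} {Mf : ℝ → ℕ → List V → ℝ}

/-- **Monotonicity on chains**: for a path functional `F` pinned by the first-step recursion,
`F T x G ≤ F T x G'` as soon as `G ≤ G'` on `N`-chains of length `T + 1` starting at `x`. -/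
theorem mono_chain (hF0 : ∀ x G, F 0 x G = G [x])
    (hFs : ∀ T x G, F (T + 1) x G = (∑ y ∈ N x, F T y (fun l => G (x :: l))) / ((N x).card : ℝ))
    (T : ℕ) (x : V) {G G' : List V → ℝ}
    (h : ∀ l : List V, l.length = T + 1 → l.getD 0 v₀ = x →
      (∀ i < T, l.getD (i + 1) v₀ ∈ N (l.getD i v₀)) → G l ≤ G' l) :
    F T x G ≤ F T x G' := by
  induction T generalizing x G G' with
  | zero =>
    rw [hF0, hF0]
    exact h _ rfl List.getD_cons_zero fun i hi => absurd hi (Nat.not_lt_zero i)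
  | succ T ih =>
    rw [hFs, hFs]
    refine div_le_div_of_nonneg_right (Finset.sum_le_sum fun y hy => ih y fun l hl hl0 hc => ?_)
      (Nat.cast_nonneg _)
    refine h (x :: l) (by rw [List.length_cons, hl]) List.getD_cons_zero fun i hi => ?_
    cases i with
    | zero => rwa [List.getD_cons_succ, List.getD_cons_zero, hl0]
    | succ i => rw [List.getD_cons_succ, List.getD_cons_succ]; exact hc i (by omega)

/-- **One-step fourth moment**: with `n = #N x ≥ 1`, `c = hgt x - a`, `ξ_y = hgt y - hgt x - d x`
(`∑_y ξ_y = 0`, `|ξ_y| ≤ 2`): `∑_{y ∈ N x} (hgt y - (a + d x))⁴ ≤ n (c⁴ + 40 c² + 32)`. -/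
theorem sum_pow_four_le (hd : ∀ x, d x = (∑ y ∈ N x, (hgt y - hgt x)) / ((N x).card : ℝ))
    (hbd : ∀ x, ∀ y ∈ N x, |hgt y - hgt x| ≤ 1) (x : V) (hx : (N x).Nonempty) (a : ℝ) :
    ∑ y ∈ N x, (hgt y - (a + d x)) ^ 4 ≤
      ((N x).card : ℝ) * ((hgt x - a) ^ 4 + 40 * (hgt x - a) ^ 2 + 32) := by
  have hn : (0 : ℝ) < (N x).card := by exact_mod_cast hx.card_pos
  have hsum' : ∑ y ∈ N x, (hgt y - hgt x) = (N x).card * d x := by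
    rw [hd x, mul_div_cancel₀ _ hn.ne']
  have hsum : ∑ y ∈ N x, (hgt y - hgt x - d x) = 0 := by
    rw [Finset.sum_sub_distrib, hsum', Finset.sum_const, nsmul_eq_mul, sub_self]
  have hdx := abs_le.mp (StubForwardKolmogorov.abs_d_le_one hd hbd x hx)
  calc ∑ y ∈ N x, (hgt y - (a + d x)) ^ 4
      ≤ ∑ y ∈ N x, ((hgt x - a) ^ 4 + 40 * (hgt x - a) ^ 2 + 32 +
          4 * (hgt x - a) ^ 3 * (hgt y - hgt x - d x)) :=
        Finset.sum_le_sum fun y hy => by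
          rw [show hgt y - (a + d x) = (hgt x - a) + (hgt y - hgt x - d x) by ring]
          refine add_pow_four_le _ _ (abs_le.2 ?_)
          have h1 := abs_le.mp (hbd x y hy)
          constructor <;> linarith [h1.1, h1.2, hdx.1, hdx.2]
    _ = ((N x).card : ℝ) * ((hgt x - a) ^ 4 + 40 * (hgt x - a) ^ 2 + 32) := by
        rw [Finset.sum_add_distrib, Finset.sum_const, nsmul_eq_mul, ← Finset.mul_sum, hsum,
          mul_zero, add_zero]

/-- **Fourth moment of the forward martingale** `F T x ((M^a_T)⁴) ≤ (hgt x - a)⁴ + 40T(hgt x - a)²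
+ 80T²` (induction on `T`: consing `M^a_{T+1}(x :: l) = M^{a + d x}_T(l)`, `sum_pow_four_le`). -/
theorem fourth_moment (hF0 : ∀ x G, F 0 x G = G [x])
    (hFs : ∀ T x G, F (T + 1) x G = (∑ y ∈ N x, F T y (fun l => G (x :: l))) / ((N x).card : ℝ))
    (hd : ∀ x, d x = (∑ y ∈ N x, (hgt y - hgt x)) / ((N x).card : ℝ))
    (hbd : ∀ x, ∀ y ∈ N x, |hgt y - hgt x| ≤ 1)
    (hMf : ∀ a t l, Mf a t l = hgt (l.getD t v₀) - a - ∑ s ∈ Finset.range t, d (l.getD s v₀))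
    (T : ℕ) (x : V) (a : ℝ) :
    F T x (fun l => Mf a T l ^ 4) ≤
      (hgt x - a) ^ 4 + 40 * (T : ℝ) * (hgt x - a) ^ 2 + 80 * (T : ℝ) ^ 2 := by
  induction T generalizing x a with
  | zero => rw [hF0, StubForwardKolmogorov.mf_cons_zero hMf]; simp
  | succ T ih =>
    rw [hFs]
    rcases (N x).eq_empty_or_nonempty with hNe | hx
    · rw [hNe, Finset.sum_empty, Finset.card_empty, Nat.cast_zero, div_zero]; positivity
    have hn : (0 : ℝ) < (N x).card := by exact_mod_cast hx.card_pos
    simp only [StubForwardKolmogorov.mf_cons_succ hMf]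
    have h2 : 40 * (T : ℝ) * ∑ y ∈ N x, (hgt y - (a + d x)) ^ 2 ≤
        40 * (T : ℝ) * (((N x).card : ℝ) * (hgt x - a) ^ 2 + 4 * (N x).card) :=
      mul_le_mul_of_nonneg_left (StubForwardKolmogorov.orthogonality hd hbd x hx a).2
        (by positivity)
    have hhi : ∑ y ∈ N x, F T y (fun l => Mf (a + d x) T l ^ 4) ≤
        ∑ y ∈ N x, ((hgt y - (a + d x)) ^ 4 + 40 * (T : ℝ) * (hgt y - (a + d x)) ^ 2 +
          80 * (T : ℝ) ^ 2) := Finset.sum_le_sum fun y _ => ih y (a + d x)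
    rw [Finset.sum_add_distrib, Finset.sum_add_distrib, Finset.sum_const, nsmul_eq_mul,
      ← Finset.mul_sum] at hhi
    rw [div_le_iff₀ hn]
    push_cast
    nlinarith [hhi, sum_pow_four_le hd hbd x hx a, h2, hn]

/-- **Heights along a nearest-neighbour path**: if consecutive sites of `l` are lattice neighbours
up to time `T`, then `h x_t ≤ h x_0 + t` and `h x_0 ≤ h x_t + t` for `t ≤ T`. -/
theorem height_le_of_chain (ω : BondConfig (Site 3)) {l : List (Site 3)} {T : ℕ}
    (hc : ∀ i < T, l.getD (i + 1) 0 ∈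
      ((zdGraph 3).neighborFinset (l.getD i 0)).filter (fun y => s(l.getD i 0, y) ∈ ω)) :
    ∀ t ≤ T, (l.getD t 0) 0 ≤ (l.getD 0 0) 0 + t ∧ (l.getD 0 0) 0 ≤ (l.getD t 0) 0 + t := by
  intro t
  induction t with
  | zero => intro; omega
  | succ t ih =>
    intro ht
    have hadj : (zdGraph 3).Adj (l.getD t 0) (l.getD (t + 1) 0) :=
      (SimpleGraph.mem_neighborFinset _ _ _).mp (Finset.mem_filter.mp (hc t ht)).1
    have h1 := SlabVoltage.apply_zero_le_of_adj hadj
    have h2 := SlabVoltage.apply_zero_le_of_adj hadj.symm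
    have h3 := ih (Nat.le_of_succ_le ht)
    push_cast
    omega

variable {D : BondConfig (Site 3) → Site 3 → ℝ}
  (hD : ∀ ω (z : Site 3), D ω z =
    (∑ y ∈ ((zdGraph 3).neighborFinset z).filter (fun y => s(z, y) ∈ ω),
        ((((y 0 : ℤ) : ℝ)) - ((z 0 : ℤ) : ℝ))) /
      ((((zdGraph 3).neighborFinset z).filter (fun y => s(z, y) ∈ ω)).card : ℝ))
include hD

/-- **Quenched fourth moment on the lattice**: `E ω T x ((h x_T - h x_0 - ∑_{s<T} D ω x_s)⁴) ≤ 80 T²`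
(`fourth_moment` for `V = ℤ³`, `N = N_ω`, `hgt z = z₀`, `d = D ω`, `a := h x`; `congr_start`). -/
theorem fourth_moment_lattice {E : BondConfig (Site 3) → ℕ → Site 3 → (List (Site 3) → ℝ) → ℝ}
    (hE0 : ∀ ω (x : Site 3) (G : List (Site 3) → ℝ), E ω 0 x G = G [x])
    (hEs : ∀ ω (T : ℕ) (x : Site 3) (G : List (Site 3) → ℝ), E ω (T + 1) x G =
      (∑ y ∈ ((zdGraph 3).neighborFinset x).filter (fun y => s(x, y) ∈ ω),
          E ω T y (fun l => G (x :: l))) /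
        ((((zdGraph 3).neighborFinset x).filter (fun y => s(x, y) ∈ ω)).card : ℝ))
    (ω : BondConfig (Site 3)) (T : ℕ) (x : Site 3) :
    E ω T x (fun l => ((((l.getD T 0) 0 : ℤ) : ℝ) - (((l.getD 0 0) 0 : ℤ) : ℝ) -
        ∑ s ∈ Finset.range T, D ω (l.getD s 0)) ^ 4) ≤ 80 * (T : ℝ) ^ 2 := by
  -- adapted from Theorems/PercGamblersRuinVerticalGamblersRuinStubForwardKolmogorov.lean
  have hbd : ∀ x' : Site 3, ∀ y ∈ ((zdGraph 3).neighborFinset x').filter (fun y => s(x', y) ∈ ω),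
      |((y 0 : ℤ) : ℝ) - ((x' 0 : ℤ) : ℝ)| ≤ 1 := fun x' y hy => by
    have hadj : (zdGraph 3).Adj x' y :=
      (SimpleGraph.mem_neighborFinset _ _ _).mp (Finset.mem_filter.mp hy).1
    have h1 := SlabVoltage.apply_zero_le_of_adj hadj
    have h2 := SlabVoltage.apply_zero_le_of_adj hadj.symm
    rw [← Int.cast_sub, ← Int.cast_abs, ← Int.cast_one, Int.cast_le, abs_le]
    omega
  rw [StubForwardKolmogorov.congr_start (v₀ := (0 : Site 3)) (hE0 ω) (hEs ω) T x
    (G' := fun l => ((((l.getD T 0) 0 : ℤ) : ℝ) - ((x 0 : ℤ) : ℝ) -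
      ∑ s ∈ Finset.range T, D ω (l.getD s 0)) ^ 4) fun l hl => by rw [hl]]
  exact (fourth_moment (v₀ := (0 : Site 3))
    (N := fun z => ((zdGraph 3).neighborFinset z).filter (fun y => s(z, y) ∈ ω)) (F := E ω)
    (hgt := fun z : Site 3 => ((z 0 : ℤ) : ℝ)) (d := D ω)
    (Mf := fun a t l => (((l.getD t 0) 0 : ℤ) : ℝ) - a - ∑ s ∈ Finset.range t, D ω (l.getD s 0))
    (hE0 ω) (hEs ω) (hD ω) hbd (fun _ _ _ => rfl) T x ((x 0 : ℤ) : ℝ)).trans_eq (by ring)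

/-- **The pathwise Lyons–Zheng bound at the endpoint.**  For `T ≥ 1`, `l = [x_0, …, x_T]` a
nearest-neighbour open path from the origin, `l' = rev l - x_T`, `ω' = ω - x_T`, `M = M_T(ω, l)`,
`M' = M_T(ω', l') = -h x_T - ∑_{s<T} D ω x_{T-s}` (`rev_functional`): `2 h x_T = M - M' + D ω x_0 - D ω x_T`
(`telescope`), `|M|, |M'| ≤ 2T`, hence `h(x_T)⁴ ≤ (27/16)(M⁴ + M'⁴ + 16) = 27T⁴(G ω l + G ω' l') + 27`. -/
theorem pathwise {T : ℕ} (hT : 1 ≤ T) {G : BondConfig (Site 3) → List (Site 3) → ℝ}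
    (hG : ∀ ω l, G ω l = min 1 (((((l.getD T 0) 0 : ℤ) : ℝ) - (((l.getD 0 0) 0 : ℤ) : ℝ) -
        ∑ s ∈ Finset.range T, D ω (l.getD s 0)) ^ 4 / (16 * (T : ℝ) ^ 4)))
    (ω : BondConfig (Site 3)) {l : List (Site 3)} (hl : l.length = T + 1) (h0 : l.getD 0 0 = 0)
    (hc : ∀ i < T, l.getD (i + 1) 0 ∈
      ((zdGraph 3).neighborFinset (l.getD i 0)).filter (fun y => s(l.getD i 0, y) ∈ ω)) :
    (((l.getD T 0) 0 : ℤ) : ℝ) ^ 4 ≤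
      27 * (T : ℝ) ^ 4 * (G ω l +
        G (BondConfig.relabel (sym2Equiv (Site.shift (-(l.getLastD 0)))) ω)
          ((l.reverse).map (fun z => z - l.getLastD 0))) + 27 * 1 := by
  have hT0 : (0 : ℝ) < T := Nat.cast_pos.2 hT
  have h16 : (0 : ℝ) < 16 * (T : ℝ) ^ 4 := by positivity
  -- the forward and backward martingales at time `T`
  obtain ⟨M, hM⟩ : ∃ M : ℝ, M = (((l.getD T 0) 0 : ℤ) : ℝ) - (((l.getD 0 0) 0 : ℤ) : ℝ) -
      ∑ s ∈ Finset.range T, D ω (l.getD s 0) := ⟨_, rfl⟩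
  obtain ⟨M', hM'⟩ : ∃ M' : ℝ, M' = (((l.getD 0 0) 0 : ℤ) : ℝ) - (((l.getD T 0) 0 : ℤ) : ℝ) -
      ∑ s ∈ Finset.range T, D ω (l.getD (T - s) 0) := ⟨_, rfl⟩
  -- bounds along the nearest-neighbour path: `h x_0 = 0`, `|h x_T| ≤ T`, `|∑ D| ≤ T`, `|D| ≤ 1`
  have h0z : (l.getD 0 0) 0 = 0 := by rw [h0]; rfl
  have ha0 : (((l.getD 0 0) 0 : ℤ) : ℝ) = 0 := by rw [h0z, Int.cast_zero]
  obtain ⟨hA, hB⟩ := height_le_of_chain ω hc T le_rfl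
  rw [h0z] at hA hB
  have a1 : (((l.getD T 0) 0 : ℤ) : ℝ) ≤ T := by exact_mod_cast (zero_add (T : ℤ)) ▸ hA
  have a2 : -(T : ℝ) ≤ (((l.getD T 0) 0 : ℤ) : ℝ) := by
    have : -(T : ℤ) ≤ (l.getD T 0) 0 := by omega
    exact_mod_cast this
  have hS : ∀ f : ℕ → Site 3, |∑ s ∈ Finset.range T, D ω (f s)| ≤ T := fun f =>
    (Finset.abs_sum_le_sum_abs _ _).trans ((Finset.sum_le_sum fun s _ =>
      StubExitTimeBound.abs_drift_le_one hD ω (f s)).trans_eq (by simp))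
  have hS1 := hS fun s => l.getD s 0
  have hS2 := hS fun s => l.getD (T - s) 0
  beta_reduce at hS1 hS2
  obtain ⟨⟨s1, s2⟩, s3, s4⟩ := And.intro (abs_le.1 hS1) (abs_le.1 hS2)
  obtain ⟨bT1, bT2⟩ := abs_le.1 (StubExitTimeBound.abs_drift_le_one hD ω (l.getD T 0))
  obtain ⟨b01, b02⟩ := abs_le.1 (StubExitTimeBound.abs_drift_le_one hD ω (l.getD 0 0))
  have hpow : ∀ m : ℝ, |m| ≤ 2 * T → m ^ 4 ≤ 16 * (T : ℝ) ^ 4 := fun m hm => by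
    have h := pow_le_pow_left₀ (abs_nonneg m) hm 4
    rw [Even.pow_abs ⟨2, rfl⟩] at h
    exact h.trans_eq (by ring)
  have hM4 := hpow M (by rw [hM, ha0, abs_le]; constructor <;> linarith)
  have hM'4 := hpow M' (by rw [hM', ha0, abs_le]; constructor <;> linarith)
  -- the truncation is inactive on nearest-neighbour paths
  have hGl : G ω l = M ^ 4 / (16 * (T : ℝ) ^ 4) := by
    rw [hG, ← hM]
    exact min_eq_right (div_le_one_of_le₀ hM4 h16.le)
  have hGr : G (BondConfig.relabel (sym2Equiv (Site.shift (-(l.getLastD 0)))) ω)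
      ((l.reverse).map (fun z => z - l.getLastD 0)) = M' ^ 4 / (16 * (T : ℝ) ^ 4) := by
    rw [hG, StubExitTimeBound.rev_functional hD ω (l.getLastD 0) hl le_rfl, Nat.sub_self, ← hM']
    exact min_eq_right (div_le_one_of_le₀ hM'4 h16.le)
  -- Lyons–Zheng at the endpoint: `2 h x_T = M - M' + (D ω x_0 - D ω x_T)`
  have key := StubExitTimeBound.telescope (fun s => (((l.getD s 0) 0 : ℤ) : ℝ))
    (fun s => D ω (l.getD s 0)) T 0
  beta_reduce at key
  simp only [add_zero, Nat.sub_zero, Nat.sub_self, Finset.range_zero, Finset.sum_empty,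
    sub_self] at key
  have key' : 2 * (((l.getD T 0) 0 : ℤ) : ℝ) = M + -M' + (D ω (l.getD 0 0) - D ω (l.getD T 0)) := by
    rw [hM, hM']; linarith [key, ha0]
  have he2 : (D ω (l.getD 0 0) - D ω (l.getD T 0)) ^ 2 ≤ 4 := by nlinarith
  have he4 : (D ω (l.getD 0 0) - D ω (l.getD T 0)) ^ 4 ≤ 16 := by
    nlinarith [sq_nonneg (D ω (l.getD 0 0) - D ω (l.getD T 0))]
  have h7 : (2 * (((l.getD T 0) 0 : ℤ) : ℝ)) ^ 4 ≤ 27 * (M ^ 4 + M' ^ 4 + 16) := by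
    rw [key']
    refine (add_add_pow_four_le M (-M') _).trans ?_
    nlinarith [he4]
  rw [hGl, hGr, show 27 * (T : ℝ) ^ 4 * (M ^ 4 / (16 * (T : ℝ) ^ 4) + M' ^ 4 / (16 * (T : ℝ) ^ 4)) =
    27 / 16 * (M ^ 4 + M' ^ 4) by field_simp]
  nlinarith [h7]

end StubFourthMoment

open StubPathReversal StubFourthMoment in
/-- **Stub `stub_fourthMoment`** of the crux `VerticalGamblersRuin` (line `registered`, rev 9;
exact registered signature): **annealed fourth moment of the height of the SRW on the open cluster
at a deterministic time** — for `T ≥ 1` and the one-step averaging operator `𝒫_ω` of the SRW on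
the open lattice edges (pinned by `hPop`), `∫_{0↔∞} deg_ω(0) · (𝒫_ω^T h⁴)(0) dP_{p_c} ≤ 1782 · T²`
with `h x = x₀`.  Proof: module docstring (`mono_chain`, `pathwise`, `fourth_moment_lattice`). -/
theorem stub_fourthMoment :
    ∀ (T : ℕ), 1 ≤ T →
      ∀ Pop : BondConfig (Site 3) → (Site 3 → ℝ) → Site 3 → ℝ,
        (∀ ω (g : Site 3 → ℝ) (x : Site 3), Pop ω g x =
          (∑ y ∈ ((zdGraph 3).neighborFinset x).filter (fun y => s(x, y) ∈ ω), g y) /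
            ((((zdGraph 3).neighborFinset x).filter (fun y => s(x, y) ∈ ω)).card : ℝ)) →
        ∫ ω in percolatesAt (0 : Site 3),
            ((((zdGraph 3).neighborFinset (0 : Site 3)).filter
                (fun y => s((0 : Site 3), y) ∈ ω)).card : ℝ) *
              ((Pop ω)^[T] (fun x => ((x 0 : ℤ) : ℝ) ^ 4)) 0
            ∂(bondPercolation (zdGraph 3) (criticalProbI 3)) ≤ 1782 * (T : ℝ) ^ 2 := by
  intro T hT Pop hPop
  -- the drift and the path functional, pinned by their formulas (no definitions)
  obtain ⟨D, hD⟩ : ∃ D : BondConfig (Site 3) → Site 3 → ℝ, ∀ ω (z : Site 3), D ω z =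
      (∑ y ∈ ((zdGraph 3).neighborFinset z).filter (fun y => s(z, y) ∈ ω),
          ((((y 0 : ℤ) : ℝ)) - ((z 0 : ℤ) : ℝ))) /
        ((((zdGraph 3).neighborFinset z).filter (fun y => s(z, y) ∈ ω)).card : ℝ) :=
    ⟨_, fun _ _ => rfl⟩
  obtain ⟨E, hE0, hEs⟩ : ∃ E : BondConfig (Site 3) → ℕ → Site 3 → (List (Site 3) → ℝ) → ℝ,
      (∀ ω (x : Site 3) (G : List (Site 3) → ℝ), E ω 0 x G = G [x]) ∧
      (∀ ω (T : ℕ) (x : Site 3) (G : List (Site 3) → ℝ), E ω (T + 1) x G =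
        (∑ y ∈ ((zdGraph 3).neighborFinset x).filter (fun y => s(x, y) ∈ ω),
            E ω T y (fun l => G (x :: l))) /
          ((((zdGraph 3).neighborFinset x).filter (fun y => s(x, y) ∈ ω)).card : ℝ)) :=
    ⟨fun ω T => Nat.rec (motive := fun _ => Site 3 → (List (Site 3) → ℝ) → ℝ) (fun x G => G [x])
      (fun _ ih x G => (∑ y ∈ ((zdGraph 3).neighborFinset x).filter (fun y => s(x, y) ∈ ω),
        ih y (fun l => G (x :: l))) /
          ((((zdGraph 3).neighborFinset x).filter (fun y => s(x, y) ∈ ω)).card : ℝ)) T,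
      fun _ _ _ => rfl, fun _ _ _ _ => rfl⟩
  have hPFB := stub_pathFunctionalBasics E hE0 hEs
  set P := bondPercolation (zdGraph 3) (criticalProbI 3) with hPdef
  set deg : BondConfig (Site 3) → ℝ := fun ω =>
    ((((zdGraph 3).neighborFinset (0 : Site 3)).filter (fun y => s((0 : Site 3), y) ∈ ω)).card : ℝ)
    with hdegdef
  have hdeg0 : ∀ ω, 0 ≤ deg ω := fun ω => Nat.cast_nonneg _
  have hdeg6 : ∀ ω, deg ω ≤ 6 := fun ω => DeterministicTime.deg_le_six ω 0
  have hdeg_meas : Measurable deg := StubStationarity.measurable_card_filter_zero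
  have hintd : ∀ Y : BondConfig (Site 3) → ℝ, Measurable Y → (∀ ω, 0 ≤ Y ω ∧ Y ω ≤ 1) →
      Integrable (fun ω => deg ω * Y ω) P := fun Y hY hb =>
    Integrable.of_bound (hdeg_meas.mul hY).aestronglyMeasurable 6 (Eventually.of_forall fun ω => by
      rw [Real.norm_eq_abs, abs_of_nonneg (mul_nonneg (hdeg0 ω) (hb ω).1)]
      nlinarith [hdeg6 ω, (hb ω).1, (hb ω).2, hdeg0 ω])
  have hT1 : (1 : ℝ) ≤ T := by exact_mod_cast hT
  -- the truncated normalised fourth power `G` of the forward martingale, its reversed copy `Gr`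
  obtain ⟨G, hGdef⟩ : ∃ G : BondConfig (Site 3) → List (Site 3) → ℝ, G = fun ω l =>
      min 1 (((((l.getD T 0) 0 : ℤ) : ℝ) - (((l.getD 0 0) 0 : ℤ) : ℝ) -
        ∑ s ∈ Finset.range T, D ω (l.getD s 0)) ^ 4 / (16 * (T : ℝ) ^ 4)) := ⟨_, rfl⟩
  have hG := fun ω l => congrFun (congrFun hGdef ω) l
  obtain ⟨Gr, hGrdef⟩ : ∃ Gr : BondConfig (Site 3) → List (Site 3) → ℝ, Gr = fun ω l =>
      G (BondConfig.relabel (sym2Equiv (Site.shift (-(l.getLastD 0)))) ω)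
        ((l.reverse).map (fun z => z - l.getLastD 0)) := ⟨_, rfl⟩
  have hG01 : ∀ ω l, 0 ≤ G ω l ∧ G ω l ≤ 1 := fun ω l => by
    rw [hG]; exact ⟨le_min zero_le_one (by positivity), min_le_left _ _⟩
  have hGr01 : ∀ ω l, 0 ≤ Gr ω l ∧ Gr ω l ≤ 1 := fun ω l => by rw [hGrdef]; exact hG01 _ _
  have hGm : ∀ l, Measurable fun ω => G ω l := fun l => by
    simp only [hG]
    exact Measurable.min measurable_const (((measurable_const.sub (Finset.measurable_sum _
      fun s _ => StubExitTimeBound.measurable_drift hD _)).pow_const 4).div_const _)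
  have hGrm : ∀ l, Measurable fun ω => Gr ω l := fun l => by
    simp only [hGrdef]
    exact (hGm _).comp (BondConfig.relabel (sym2Equiv (Site.shift (-(l.getLastD 0))))).measurable
  have hlink : ∀ ω, ((Pop ω)^[T] (fun x => ((x 0 : ℤ) : ℝ) ^ 4)) 0 =
      E ω T 0 (fun l => (((l.getD T 0) 0 : ℤ) : ℝ) ^ 4) := fun ω =>
    (hPFB ω T 0).2.2.2.2.2.2.1 Pop hPop _
  -- pointwise: `deg·(𝒫^T h⁴)(0) ≤ 27 T⁴ (deg·E(G ω) + deg·E(Gr ω)) + 162` and `54 T⁴·deg·E(G ω) ≤ 1620 T²`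
  have k : ∀ ω, deg ω * ((Pop ω)^[T] (fun x => ((x 0 : ℤ) : ℝ) ^ 4)) 0 ≤
      27 * (T : ℝ) ^ 4 * (deg ω * E ω T 0 (Gr ω) - deg ω * E ω T 0 (G ω)) + 1782 * (T : ℝ) ^ 2 := by
    intro ω
    obtain ⟨hmono, hlin, -, hmass, -, -, -, -⟩ := hPFB ω T 0
    have hE : E ω T 0 (fun l => (((l.getD T 0) 0 : ℤ) : ℝ) ^ 4) ≤
        27 * (T : ℝ) ^ 4 * (E ω T 0 (G ω) + E ω T 0 (Gr ω)) + 27 := by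
      calc E ω T 0 (fun l => (((l.getD T 0) 0 : ℤ) : ℝ) ^ 4)
          ≤ E ω T 0 (fun l => 27 * (T : ℝ) ^ 4 * (G ω l + Gr ω l) + 27 * 1) :=
            mono_chain (v₀ := (0 : Site 3))
              (N := fun z => ((zdGraph 3).neighborFinset z).filter (fun y => s(z, y) ∈ ω))
              (hE0 ω) (hEs ω) T 0 fun l hl hl0 hc => by
                rw [hGrdef]; exact pathwise hD hT hG ω hl hl0 hc
        _ = 27 * (T : ℝ) ^ 4 * E ω T 0 (fun l => G ω l + Gr ω l) +
              27 * E ω T 0 (fun _ => (1 : ℝ)) := hlin _ _ _ _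
        _ ≤ 27 * (T : ℝ) ^ 4 * (E ω T 0 (G ω) + E ω T 0 (Gr ω)) + 27 := by
            rw [StubPathFunctionalBasics.add (hE0 ω) (hEs ω) T 0 (G ω) (Gr ω)]
            nlinarith [hmass]
    -- quenched fourth moment: `16 T⁴ E(G ω) ≤ E(M_T⁴) ≤ 80 T²`
    have h3 : 16 * (T : ℝ) ^ 4 * E ω T 0 (G ω) ≤ 80 * (T : ℝ) ^ 2 := by
      rw [← StubPathFunctionalBasics.smul (hE0 ω) (hEs ω) T 0]
      refine (hmono _ _ fun l => ?_).trans (fourth_moment_lattice hD hE0 hEs ω T 0)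
      rw [hG]
      exact (mul_le_mul_of_nonneg_left (min_le_right _ _) (by positivity)).trans_eq
        (mul_div_cancel₀ _ (by positivity))
    rw [hlink]
    have h6 : deg ω * (T : ℝ) ^ 2 ≤ 6 * (T : ℝ) ^ 2 := mul_le_mul_of_nonneg_right (hdeg6 ω) (sq_nonneg _)
    nlinarith [mul_le_mul_of_nonneg_left hE (hdeg0 ω), mul_le_mul_of_nonneg_left h3 (hdeg0 ω),
      hdeg6 ω, hdeg0 ω, hT1]
  -- integrability
  have iG : Integrable (fun ω => deg ω * E ω T 0 (G ω)) P :=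
    hintd _ (measurable_E hE0 hEs T 0 hGm) fun ω => E_mem_Icc hE0 hEs ω T 0 (hG01 ω)
  have iGr : Integrable (fun ω => deg ω * E ω T 0 (Gr ω)) P :=
    hintd _ (measurable_E hE0 hEs T 0 hGrm) fun ω => E_mem_Icc hE0 hEs ω T 0 (hGr01 ω)
  have iD : Integrable (fun ω => 27 * (T : ℝ) ^ 4 *
      (deg ω * E ω T 0 (Gr ω) - deg ω * E ω T 0 (G ω))) P := (iGr.sub iG).const_mul _
  have iL : Integrable (fun ω => deg ω * ((Pop ω)^[T] (fun x => ((x 0 : ℤ) : ℝ) ^ 4)) 0) P := by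
    refine (iD.add (integrable_const (1782 * (T : ℝ) ^ 2))).mono' ((hdeg_meas.mul (DeterministicTime.measurable_full_iterate
      (F := fun _ x => ((x 0 : ℤ) : ℝ) ^ 4) (fun _ => measurable_const) hPop T 0))
        |>.aestronglyMeasurable) (Eventually.of_forall fun ω => ?_)
    rw [Real.norm_eq_abs, abs_of_nonneg (mul_nonneg (hdeg0 ω) ?_)]
    · exact k ω
    · rw [hlink]
      exact StubPathFunctionalBasics.nonneg (hE0 ω) (hEs ω) T 0 fun l => by positivity
  -- reversal, and integration over `{0 ↔ ∞}`
  have hrev : ∫ ω in percolatesAt (0 : Site 3), deg ω * E ω T 0 (G ω) ∂P =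
      ∫ ω in percolatesAt (0 : Site 3), deg ω * E ω T 0 (Gr ω) ∂P := by
    simp only [hGrdef]
    exact stub_pathReversal E hE0 hEs T G hGm hG01
  calc ∫ ω in percolatesAt (0 : Site 3),
        deg ω * ((Pop ω)^[T] (fun x => ((x 0 : ℤ) : ℝ) ^ 4)) 0 ∂P
      ≤ ∫ ω in percolatesAt (0 : Site 3), (27 * (T : ℝ) ^ 4 *
          (deg ω * E ω T 0 (Gr ω) - deg ω * E ω T 0 (G ω)) + 1782 * (T : ℝ) ^ 2) ∂P :=
        setIntegral_mono iL.integrableOn (iD.add (integrable_const _)).integrableOn k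
    _ ≤ 1782 * (T : ℝ) ^ 2 := by
        rw [integral_add iD.integrableOn (integrable_const _).integrableOn, integral_const_mul,
          integral_sub iGr.integrableOn iG.integrableOn, setIntegral_const, smul_eq_mul, hrev,
          sub_self, mul_zero, zero_add]
        exact mul_le_of_le_one_left (by positivity) measureReal_le_one

end Summit.CriticalPhenomena.PercolationContinuityZ3.Theorems.VerticalGamblersRuin
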